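import Summits.AtomisticToContinuum.HydrodynamicLimit.Theorems.OneFlightGossipEngineEquilibriumClampedCollisionalWindowLDStubMeasurability
import Summits.AtomisticToContinuum.HydrodynamicLimit.Theorems.OneFlightGossipEngineEquilibriumClampedCollisionalWindowLDCompositionC1

/-!
# The compensator defect `X̃ − M_H − K_exp` is a.e.-measurable under the Gibbs law
(crux `EquilibriumClampedCollisionalWindowLD`, stmt-AtomisticToContinuum-13733; line `coarse-coin-entropy-chain`;
stub `stub_compensatorDefectLD` (S5), third conjunct — registered sub-goal `compensatorDefect_defect_aemeasurable`)

Support file (`--supports stmt-AtomisticToContinuum-13733`) in the vocabulary of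
`Theorems/OneFlightGossipEngineEquilibriumClampedCollisionalWindowLDDefs` (`Flow`, `Phase`, `Rec`, `gibbs`, `window`, `Xa`,
`Kexp`, `kappaRow`, `payload`, `coinCount`, `coinTime`, `coinMark`, `innov`), on top of the coin-measurability files
`…WindowLDCoinTimesC1` (guard events, coin decomposition `collisionSum_Ioc_eq_sum_range`), `…WindowLDCoinRecordsC1`
(records and clamps at a coin on its guard event; `compensatorDefect_coinMark_measurable`), `…WindowLDStubMeasurability`
(`measurable_indicator_sum_range`, `aemeasurable_of_measurable_indicator_good`, `gibbs_compl_good`) and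
`…WindowLDCompositionC1` (`measurable_innov`). No new definitions. Pure measurability:

* `measurable_kappaRow`: the explicit one-coin compensators `κ_r` are measurable functionals of the record for smooth
  `φ` (polynomial in the incoming pair velocities and in `∇φ(x_fst)`, the latter continuous);
* `indicator_Xa_eq_indicator_sum_coinMark` / `measurable_indicator_Xa`: on the good set the adapted-clamped transfer IS
  the sum of its coin marks, `X̃ = Σ_{n < coinCount} T_n`, a sum with a random number of measurable terms;
* `measurable_indicator_Kexp`: the explicit predictable compensator, extended by `0` off the good set, is measurable
  (coin decomposition; predictable clamps and records at the coins are measurable on the guard events);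
* `compensatorDefect_defect_aemeasurable` (registered signature verbatim): `X̃ − M_H − K_exp` is `G_N`-a.e. measurable,
  since `G_N` is carried by the good set and the innovation sum `M_H` is measurable along any filtration carrying the
  marks.

Hypothesis `0 < σ < 1/2` throughout (hard-sphere regularity of the torus geometry at diameter `ε_N ≤ σ`).
-/

noncomputable section

open MeasureTheory ProbabilityTheory Set Filter
open scoped ENNReal BigOperators
open Literature.Analysis.FluidPDE Literature.MathematicalPhysics.KineticTheory
open Literature.Analysis.FunctionSpaces (Torus.partialDeriv Torus.IsSmooth)

namespace Summit.AtomisticToContinuum.HydrodynamicLimit.Theorems.ClampedTransferCoin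

variable {σ : ℝ} {N : ℕ}

/-! ## The explicit one-coin compensators are measurable functionals of the record -/

/-- **The explicit one-coin compensators `κ_r` are measurable in the record** for smooth `φ`: they are polynomial in
the incoming velocities `v_fst⁻, v_snd⁻` (measurable fields of the record), in `‖g‖^{±1}` and in `∇φ(x_fst)`
(continuous in the measurable field `x_fst`). -/
theorem measurable_kappaRow (σ : ℝ) {φ : T3 → ℝ} (hφ : Torus.IsSmooth φ) (N : ℕ) (r : Option (Fin 3)) :
    Measurable (kappaRow σ φ N r : Rec N → ℝ) := by
  have hk : ∀ l : Fin 3, Measurable fun v : V3 => v l := fun l => (PiLp.continuous_apply 2 _ l).measurable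
  have hg : Measurable fun c : Rec N => c.preVel.1 - c.preVel.2 :=
    HardSphereCollisionRecord.measurable_preVel.fst.sub HardSphereCollisionRecord.measurable_preVel.snd
  have hU : Measurable fun c : Rec N => c.preVel.1 + c.preVel.2 :=
    HardSphereCollisionRecord.measurable_preVel.fst.add HardSphereCollisionRecord.measurable_preVel.snd
  have hgl : ∀ l : Fin 3, Measurable fun c : Rec N => (c.preVel.1 - c.preVel.2) l := fun l => (hk l).comp hg
  have hUl : ∀ l : Fin 3, Measurable fun c : Rec N => (2 : ℝ)⁻¹ * (c.preVel.1 + c.preVel.2) l := fun l =>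
    ((hk l).comp hU).const_mul _
  have hd : ∀ l : Fin 3, Measurable fun c : Rec N => Torus.partialDeriv l φ c.fstPos := fun l =>
    (hφ.partialDeriv l).continuous.measurable.comp HardSphereCollisionRecord.measurable_fstPos
  have hgd : Measurable fun c : Rec N => ∑ l, (c.preVel.1 - c.preVel.2) l * Torus.partialDeriv l φ c.fstPos :=
    Finset.measurable_sum _ fun l _ => (hgl l).mul (hd l)
  cases r with
  | none =>
    show Measurable fun c : Rec N => hsDiameter σ N / 15 *
        ((∑ l, ((2 : ℝ)⁻¹ * (c.preVel.1 + c.preVel.2) l) * Torus.partialDeriv l φ c.fstPos) *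
            ‖c.preVel.1 - c.preVel.2‖ ^ 2 +
          2 * (∑ l, (c.preVel.1 - c.preVel.2) l * Torus.partialDeriv l φ c.fstPos) *
            (∑ l, (c.preVel.1 - c.preVel.2) l * ((2 : ℝ)⁻¹ * (c.preVel.1 + c.preVel.2) l))) /
        ‖c.preVel.1 - c.preVel.2‖
    exact ((((Finset.measurable_sum _ fun l _ => (hUl l).mul (hd l)).mul (hg.norm.pow_const 2)).add
      ((hgd.const_mul 2).mul (Finset.measurable_sum _ fun l _ => (hgl l).mul (hUl l)))).const_mul _).div hg.norm
  | some k =>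
    show Measurable fun c : Rec N => hsDiameter σ N / 15 *
        (2 * (∑ l, (c.preVel.1 - c.preVel.2) l * Torus.partialDeriv l φ c.fstPos) * (c.preVel.1 - c.preVel.2) k +
          ‖c.preVel.1 - c.preVel.2‖ ^ 2 * Torus.partialDeriv k φ c.fstPos) / ‖c.preVel.1 - c.preVel.2‖
    exact ((((hgd.const_mul 2).mul (hgl k)).add ((hg.norm.pow_const 2).mul (hd k))).const_mul _).div hg.norm

/-! ## The adapted-clamped transfer and the explicit compensator on the good set -/

/-- **On the good set the adapted-clamped transfer is the sum of its coin marks**, `X̃ = Σ_{n < coinCount} T_n`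
(coin decomposition of the window collision sum; the guard of `T_n` holds for `n < coinCount` on the good set). -/
theorem indicator_Xa_eq_indicator_sum_coinMark (τ V : ℝ) (φ : T3 → ℝ) (Φ : Flow σ N) (r : Option (Fin 3)) :
    Φ.good.indicator (Xa σ τ V φ Φ r) =
      Φ.good.indicator fun z => ∑ n ∈ Finset.range (coinCount σ τ Φ z), coinMark σ τ V φ Φ r n z := by
  refine Set.indicator_congr fun z hz => ?_
  rw [Xa, collisionSum_Ioc_eq_sum_range Φ hz, ← coinCount_eq]
  refine Finset.sum_congr rfl fun n hn => ?_
  unfold coinMark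
  rw [if_pos ⟨hz, Finset.mem_range.1 hn⟩]

/-- **The adapted-clamped transfer, extended by `0` off the good set, is measurable in the datum** (for measurable
`φ`): a sum with a random number of terms, each a measurable coin mark. -/
theorem measurable_indicator_Xa (hσ : 0 < σ) (hσ2 : σ < 1 / 2) (τ V : ℝ) {φ : T3 → ℝ} (hφ : Measurable φ)
    (Φ : Flow σ N) (r : Option (Fin 3)) : Measurable (Φ.good.indicator (Xa σ τ V φ Φ r)) := by
  rw [indicator_Xa_eq_indicator_sum_coinMark]
  exact measurable_indicator_sum_range (measurableSet_coinGuard hσ hσ2 τ Φ) fun n =>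
    (compensatorDefect_coinMark_measurable hσ hσ2 τ V hφ N Φ r n).comp measurable_subtype_coe

/-- **The explicit predictable compensator, extended by `0` off the good set, is measurable in the datum** (for
smooth `φ`): by the coin decomposition it is `Σ_{n < coinCount} Σ_{(i,j) at coin n} ω̃⁻_i ω̃⁻_j κ_r(record)`, a sum with
a random number of terms each of which is a finite sum of products of functions measurable on its guard event. -/
theorem measurable_indicator_Kexp (hσ : 0 < σ) (hσ2 : σ < 1 / 2) (τ V : ℝ) {φ : T3 → ℝ} (hφ : Torus.IsSmooth φ)
    (Φ : Flow σ N) (r : Option (Fin 3)) : Measurable (Φ.good.indicator (Kexp σ τ V φ Φ r)) := by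
  have heq : Φ.good.indicator (Kexp σ τ V φ Φ r) =
      Φ.good.indicator fun z => ∑ n ∈ Finset.range (coinCount σ τ Φ z),
        ∑ p ∈ contactPairs (Torus.geometry (Fin 3)) (hsDiameter σ N) (Φ.flow (coinTime Φ z n) z),
          flagP σ τ V Φ (coinTime Φ z n) p.1 z * flagP σ τ V Φ (coinTime Φ z n) p.2 z *
            kappaRow σ φ N r (HardSphereCollisionRecord.ofConfig (Torus.geometry (Fin 3)) (hsDiameter σ N)
              (Φ.flow (coinTime Φ z n) z) (coinTime Φ z n) p.1 p.2) := by
    refine Set.indicator_congr fun z hz => ?_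
    rw [Kexp, collisionSum_Ioc_eq_sum_range Φ hz]
    simp only [HardSphereCollisionRecord.ofConfig_time, HardSphereCollisionRecord.ofConfig_fst,
      HardSphereCollisionRecord.ofConfig_snd, coinCount_eq]
  rw [heq]
  refine measurable_indicator_sum_range (measurableSet_coinGuard hσ hσ2 τ Φ) fun n => ?_
  refine measurable_sum_contactPairs_of_measurable (measurable_flow_coinTime_guard hσ hσ2 τ Φ le_rfl)
    fun p => ?_
  exact ((measurable_flagP_coinTime_guard hσ hσ2 τ V Φ n p.1).mul
    (measurable_flagP_coinTime_guard hσ hσ2 τ V Φ n p.2)).mul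
    ((measurable_kappaRow σ hφ N r).comp (measurable_record_guard hσ hσ2 τ Φ le_rfl p.1 p.2))

/-! ## The registered sub-goal -/

/-- **S5, third conjunct · the compensator defect is a.e.-measurable under the Gibbs law** (registered sub-goal of
`stub_compensatorDefectLD`): for `0 < σ < 1/2`, smooth `φ` and any filtration `ℱ` of phase space along which the coin
marks are adapted, `z ↦ X̃(z) − M_H(z) − K_exp(z)` is `G_N`-a.e. measurable — `X̃ − K_exp` is measurable after extension
by `0` off the good set, which carries `G_N`, and the innovation sum `M_H` is measurable outright. -/
theorem compensatorDefect_defect_aemeasurable {σ : ℝ} (hσ : 0 < σ) (hσ2 : σ < 1 / 2) (a₀ θ₀ : ℝ) (u₀ : V3)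
    (τ V : ℝ) {φ : T3 → ℝ} (hφ : Torus.IsSmooth φ) (N : ℕ) (Φ : Flow σ N)
    (ℱ : Filtration ℕ (inferInstance : MeasurableSpace (Phase N)))
    (hℱ : ∀ (r : Option (Fin 3)) (n : ℕ), StronglyMeasurable[ℱ (n + 1)] (coinMark σ τ V φ Φ r n))
    (r : Option (Fin 3)) (H : ℕ) :
    AEMeasurable (fun z => Xa σ τ V φ Φ r z - innov σ a₀ θ₀ u₀ τ V φ Φ ℱ r H z - Kexp σ τ V φ Φ r z)
      (gibbs σ a₀ θ₀ u₀ N Φ) := by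
  have hXK : Measurable (Φ.good.indicator (Xa σ τ V φ Φ r - Kexp σ τ V φ Φ r)) := by
    rw [Set.indicator_sub']
    exact (measurable_indicator_Xa hσ hσ2 τ V hφ.continuous.measurable Φ r).sub
      (measurable_indicator_Kexp hσ hσ2 τ V hφ Φ r)
  have heq : (fun z => Xa σ τ V φ Φ r z - innov σ a₀ θ₀ u₀ τ V φ Φ ℱ r H z - Kexp σ τ V φ Φ r z) =
      fun z => (Xa σ τ V φ Φ r - Kexp σ τ V φ Φ r) z - innov σ a₀ θ₀ u₀ τ V φ Φ ℱ r H z := by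
    funext z
    rw [Pi.sub_apply, sub_right_comm]
  rw [heq]
  exact (aemeasurable_of_measurable_indicator_good Φ hXK (gibbs_compl_good σ a₀ θ₀ u₀ N Φ)).sub
    (measurable_innov Φ ℱ r H (hℱ r)).aemeasurable

end Summit.AtomisticToContinuum.HydrodynamicLimit.Theorems.ClampedTransferCoin

end
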